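import Summits.Parity.GeneralizedHardyLittlewood.Theses.LeeYangFibres
import Literature.NumberTheory.Sieve.LinearEquationsInPrimesDimOne
import HarnessLib

/-!
# Crux `PrimeCellsRelative` (stmt-Parity-14112): the absolute error term is load-bearing

Negative-side support (refuter cdisprove seat). `PrimeCellsRelative` bounds the deviation of the
rough prime cell count from its model `M₁ = β_∞ 𝔖 (A₁(N)/N)^t` by `ε (M₁ + N / log^t N)`
(Green–Tao Conj. 1.4 error shape: relative + absolute). Here we record, sorry-free, that the
ABSOLUTE term `N / log^t N` cannot be dropped: the purely relative statement
`|count − M₁| ≤ ε M₁` (stated inline below; no proposition is defined under `Summits/`) is false —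
a one-point convex body `K = {P}` at a Bertrand prime `P ∈ (N/2, N]` has `β_∞ = 0`, hence `M₁ = 0`,
but contains the prime point `P > N^{1/2} ≥ N^{1/u}` of the one-form system `ψ(n) = n`.

Moral for provers: relative accuracy is only available on bodies carrying main-term mass; any
proof of the crux must route small / thin `K` through the absolute term. This file does NOT
refute the crux.
-/

noncomputable section

namespace Summit.Parity.GeneralizedHardyLittlewood.Theorems.PrimeCellsRelative.Negative

open scoped BigOperators Topology Classical MeasureTheory
open Filter Set Function MeasureTheory Finset Literature.NumberTheory.Sieve

/-- **The absolute error term of `PrimeCellsRelative` cannot be dropped.** The purely relative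
variant (error `ε · β_∞ 𝔖 (A₁/N)^t`, no `+ N/log^t N`) fails at `t = 1`, `L = 1` for the system
`ψ(n) = n` and the singleton body `K = {P}`, `P` a prime in `(N/2, N]` (Bertrand): the left side
counts the point `P` (a prime `> N/2 ≥ √N ≥ N^{1/u}`), the right side is `ε · 0 = 0` because a
point has Lebesgue measure zero. [folklore] -/
theorem primeCellsRelative_false_without_absoluteError :
    ¬ (∀ (t L : ℕ), 1 ≤ t → ∀ ε : ℝ, 0 < ε → ∃ u : ℕ, 2 ≤ u ∧ ∃ N₀ : ℕ, ∀ N : ℕ, N₀ ≤ N →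
      ∀ Ψ : Fin t → Literature.NumberTheory.Sieve.AffLinForm 1,
        Literature.NumberTheory.Sieve.IsNondegenerateSystem Ψ →
        Literature.NumberTheory.Sieve.affLinSize Ψ N ≤ L →
        ∀ K : Set (Fin 1 → ℝ), Convex ℝ K → K ⊆ Literature.NumberTheory.Sieve.realBox 1 N →
          |((((Literature.NumberTheory.Sieve.latticeBox 1 N).filter (fun n =>
              Literature.NumberTheory.Sieve.realPoint n ∈ K ∧ ∀ i, (N : ℝ) ^ ((1 : ℝ) / u) <
                (Nat.minFac ((Ψ i).eval n).toNat : ℝ) ∧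
                ArithmeticFunction.cardFactors ((Ψ i).eval n).toNat = 1)).card : ℕ) : ℝ) -
            Literature.NumberTheory.Sieve.archFactor Ψ K *
              Literature.NumberTheory.Sieve.singularProduct Ψ *
              (((((Finset.Icc 1 N).filter (fun m => (N : ℝ) ^ ((1 : ℝ) / u) < (Nat.minFac m : ℝ) ∧
                ArithmeticFunction.cardFactors m = 1)).card : ℕ) : ℝ) / N) ^ t| ≤
          ε * (Literature.NumberTheory.Sieve.archFactor Ψ K *
              Literature.NumberTheory.Sieve.singularProduct Ψ *
              (((((Finset.Icc 1 N).filter (fun m => (N : ℝ) ^ ((1 : ℝ) / u) < (Nat.minFac m : ℝ) ∧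
                ArithmeticFunction.cardFactors m = 1)).card : ℕ) : ℝ) / N) ^ t)) := by
  intro h
  obtain ⟨u, hu2, N₀, hN₀⟩ := h 1 1 le_rfl 1 one_pos
  -- the scale `N = 2 n`, `n = max N₀ 2`, and a Bertrand prime `n < P ≤ 2 n`
  obtain ⟨P, hP, hnP, hPN⟩ := Nat.exists_prime_lt_and_le_two_mul (max N₀ 2) (by omega)
  have hb := hN₀ (2 * max N₀ 2) (by omega) (fun _ => ⟨fun _ => 1, 0⟩) ?_ ?_
    {fun _ => (P : ℝ)} (convex_singleton _) ?_
  · -- the main term vanishes: `β_∞({P}) = 0`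
    have harch : Literature.NumberTheory.Sieve.archFactor
        (fun _ : Fin 1 => (⟨fun _ => 1, 0⟩ : AffLinForm 1)) {fun _ : Fin 1 => (P : ℝ)} = 0 := by
      rw [DimOne.archFactor_eq, ENNReal.toReal_eq_zero_iff]
      left
      refine measure_mono_null (fun r hr => ?_) (Real.volume_singleton (a := (P : ℝ)))
      have h1 := congr_fun hr.1 0
      exact h1
    rw [harch] at hb
    simp only [zero_mul, mul_zero, sub_zero, Nat.abs_cast] at hb
    -- but the point `(P)` is counted
    have key : ∀ {s : Finset (Fin 1 → ℤ)}, ((s.card : ℕ) : ℝ) ≤ 0 → (fun _ => (P : ℤ)) ∈ s → False := by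
      intro s hs hm
      have h1 : (0 : ℝ) < s.card := by exact_mod_cast Finset.card_pos.mpr ⟨_, hm⟩
      linarith
    have hev : ((⟨fun _ => 1, 0⟩ : AffLinForm 1)).eval (fun _ : Fin 1 => (P : ℤ)) = P := by
      simp [AffLinForm.eval]
    refine key hb ?_
    simp only [Finset.mem_filter]
    refine ⟨?_, ?_, fun _ => ?_⟩
    · unfold Literature.NumberTheory.Sieve.latticeBox
      rw [Fintype.mem_piFinset]
      intro j
      rw [Finset.mem_Icc]
      constructor <;> push_cast <;> omega
    · show (fun _ : Fin 1 => ((P : ℤ) : ℝ)) ∈ ({fun _ => (P : ℝ)} : Set (Fin 1 → ℝ))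
      simp
    · simp only [hev, Int.toNat_natCast, Nat.Prime.minFac_eq hP,
        ArithmeticFunction.cardFactors_apply_prime hP, and_true]
      -- `N^{1/u} ≤ N^{1/2} = √N ≤ N/2 = n < P`
      have hN4 : (4 : ℝ) ≤ ((2 * max N₀ 2 : ℕ) : ℝ) := by
        have : (4 : ℕ) ≤ 2 * max N₀ 2 := by omega
        exact_mod_cast this
      have hN1 : (1 : ℝ) ≤ ((2 * max N₀ 2 : ℕ) : ℝ) := by linarith
      have hu : (1 : ℝ) / u ≤ 1 / 2 := by
        gcongr
        exact_mod_cast hu2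
      calc ((2 * max N₀ 2 : ℕ) : ℝ) ^ ((1 : ℝ) / u)
          ≤ ((2 * max N₀ 2 : ℕ) : ℝ) ^ ((1 : ℝ) / 2) := Real.rpow_le_rpow_of_exponent_le hN1 hu
        _ = Real.sqrt ((2 * max N₀ 2 : ℕ) : ℝ) := by rw [Real.sqrt_eq_rpow]
        _ ≤ ((2 * max N₀ 2 : ℕ) : ℝ) / 2 := by
            rw [Real.sqrt_le_left (by positivity)]
            nlinarith
        _ = ((max N₀ 2 : ℕ) : ℝ) := by push_cast; ring
        _ < P := by exact_mod_cast hnP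
  · -- non-degenerate: the one form `n` is non-constant (no pairs to compare)
    refine ⟨fun i h0 => ?_, fun i j hij => absurd (Subsingleton.elim i j) hij⟩
    have := congr_fun h0 0
    simp at this
  · -- size `‖Ψ‖_N = 1`
    simp [Literature.NumberTheory.Sieve.affLinSize]
  · -- `{P} ⊆ [-N, N]`
    intro x hx
    rw [Set.mem_singleton_iff] at hx
    subst hx
    simp only [Literature.NumberTheory.Sieve.realBox, Set.mem_Icc]
    have h1 : (P : ℝ) ≤ ((2 * max N₀ 2 : ℕ) : ℝ) := by exact_mod_cast hPN
    have h2 : (0 : ℝ) ≤ P := Nat.cast_nonneg P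
    constructor <;> intro _ <;> simp only <;> linarith

end Summit.Parity.GeneralizedHardyLittlewood.Theorems.PrimeCellsRelative.Negative

end
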